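import Literature.AlgebraicGeometry.Resolution.LinearSectionsSingularLocus
import Literature.AlgebraicGeometry.Resolution.LinearSectionsLocalDim
import Literature.AlgebraicGeometry.Resolution.LinearProjectionZJets
import HarnessLib

/-!
# Choosing the linear forms `t₀, …, t_{d+1}` of de Jong's Lemma 4.11

Topic: `Literature/AlgebraicGeometry/Resolution`. The generic choice behind the projection
`π = (t₀ : … : t_{d+1}) : X → ℙ^{d+1}_k` of the proof of de Jong 1996, Lemma 4.11 (p. 68: "we
choose […] general […]. By Bertini's theorem we may choose `π` such that the general fibre of `f`
is smooth […] `Z → π(Z) → ℙ^{d-1}` is generically étale by construction", the construction being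
2.11) — assembled from the sequential-choice bookkeeping `exists_seq_of_isGeneric` and the
generic conditions of `LinearSectionsChoice`, `LinearSectionsBertini`, `LinearSectionsJets`.

For `k` algebraically closed, `X ↪ ℙ^N_k` an integral projective closed subscheme of dimension
`d + 1` and `Z = Supp D` the support of an effective Cartier divisor, `LinSec.exists_goodForms`
produces `t : Fin (d + 2) → k^{N+1}` such that

* (C1) `t₀, …, t_{d+1}` have no common zero on `X` (the projection is a morphism);
* (C2) `t₀, …, t_d` have no common zero on `Z` (`vertex ∉ π(Z)`);
* (C3) every common zero `x` of `t₀, …, t_d` is a closed point with `(t₀, …, t_d)_x = 𝔪_x`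
  (`π` unramified, hence étale, over the vertex: Bertini along the sequence, `LinearSectionsChoice`,
  and `cutIdeal_eq_maximalIdeal`, `LinearSectionsLocalDim`);
* (C4) every irreducible component of `Z` contains a closed point `z` with `𝒪_{X,z}/I_z` regular of
  dimension `d`, `t₀(z) ≠ 0` and the jets of `t₀, …, t_d` at `z` linearly independent modulo `I_z`
  (`Lemma411DivisorPoints`, `isGeneric_jetMap_notMem`) — so that `pr ∘ π|_Z` is generically étale
  (`LinearProjectionZJets`, `LinearProjectionZEtale`);
* (C5) if `X` is normal: at every closed common zero `x` of `t₀, …, t_{d-1}`, the quotient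
  `𝒪_{X,x}/(t₀, …, t_{d-1})` is regular of dimension `≤ 1` (`Sing X` has codimension `≥ 2`,
  `LinearSectionsSingularLocus`, and Bertini) — so that a fibre of `f` is smooth.

Everything is proved; no named facts.

## References

* A. J. de Jong, *Smoothness, semi-stability and alterations*, Publ. Math. IHÉS 83 (1996), 2.11
  and proof of Lemma 4.11, p. 68. [DeJong1996]
* R. Hartshorne, *Algebraic Geometry* (1977), II Thm. 8.18 (Bertini), I Thm. 7.2. [Hartshorne1977]
-/

noncomputable section

open CategoryTheory AlgebraicGeometry TopologicalSpace Topology Opposite IsLocalRing Order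
open Literature.AlgebraicGeometry.Morphisms.ProjCech (grading PP)
open Literature.AlgebraicGeometry.Motives
open Literature.AlgebraicGeometry.Motives.RatFn
open Literature.Topology
open Scheme.IdealSheafData

attribute [local instance] MvPolynomial.gradedAlgebra
  Literature.AlgebraicGeometry.Motives.ProjBaseChange.algebraBase

namespace Literature.AlgebraicGeometry.Resolution

universe u

namespace LinSec

open BertiniAffine DeJong1996

variable {k : Type u} [Field k] [IsAlgClosed k] {N : ℕ} {X : Scheme.{u}} [IsIntegral X]
  [X.Over (Spec (.of k))] (ι : X ⟶ PP k N) [IsClosedImmersion ι]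
  (hι : ι ≫ Literature.AlgebraicGeometry.Morphisms.ProjCech.toSpec k N = X ↘ Spec (.of k))
  [IsProper (X ↘ Spec (.of k))] {d : ℕ} (hdim : topologicalKrullDim X = (d + 1 : ℕ))
  {Z : Set X} (hZ : IsClosed Z) {D : X.IdealSheafData} (hD : IsEffectiveCartier D)
  (hZD : (D.support : Set X) = Z)

/-! ## Preliminaries: dimensions of `X`, `Z`, `Sing X` -/

omit [IsAlgClosed k] [IsClosedImmersion ι] [IsProper (X ↘ Spec (.of k))] [IsIntegral X] in
include hdim in
/-- `dim X < d + 2`, read on the subspace `univ`. [folklore] -/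
theorem topologicalKrullDim_univ_lt : topologicalKrullDim ↥(Set.univ : Set X) < ((d + 1) + 1 : ℕ) := by
  rw [IsHomeomorph.topologicalKrullDim_eq _ (Homeomorph.Set.univ X).isHomeomorph, hdim]
  exact_mod_cast Nat.lt_succ_self _

omit [IsAlgClosed k] [IsClosedImmersion ι] [IsProper (X ↘ Spec (.of k))] in
include hZ hdim hD hZD in
/-- `dim Z < d + 1` (`Z = Supp D` misses the generic point). [folklore] -/
theorem topologicalKrullDim_Z_lt : topologicalKrullDim ↥Z < (d + 1 : ℕ) := by
  have hne : Z ≠ Set.univ := fun h => DeJong1996.NormalProjectivePair.genericPoint_notMem_support hD (by rw [hZD, h]; trivial)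
  have := DeJong1996.topologicalKrullDim_le_of_ne_univ hZ hdim hne
  exact lt_of_le_of_lt this (by exact_mod_cast Nat.lt_succ_self d)

omit [IsAlgClosed k] [IsClosedImmersion ι] in
include hdim in
/-- `dim Sing X < d + 1` (the generic point is regular). [folklore] -/
theorem topologicalKrullDim_singSet_lt_succ [PerfectField k] :
    topologicalKrullDim ↥(singSet X) < (d + 1 : ℕ) := by
  have hne : singSet X ≠ Set.univ := fun h => genericPoint_notMem_singSet (X := X) (by rw [h]; trivial)
  have := DeJong1996.topologicalKrullDim_le_of_ne_univ (isClosed_singSet (X ↘ Spec (.of k))) hdim hne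
  exact lt_of_le_of_lt this (by exact_mod_cast Nat.lt_succ_self d)

/-! ## The choice -/

include hι hdim hD hZD in
set_option maxHeartbeats 1600000 in
/-- **The linear forms of de Jong's Lemma 4.11.** See the module docstring for (C1)–(C5).
[cite: DeJong1996, Lemma 4.11 (proof), p. 68 and 2.11] [cite: Hartshorne1977, II Thm. 8.18] -/
theorem exists_goodForms :
    ∃ t : Fin (d + 1 + 1) → Fin (N + 1) → k,
      NoCommonZero ι t ∧
      (∀ z ∈ Z, z ∉ cutSet ι (tInit t)) ∧
      (∀ x : X, x ∈ cutSet ι (tInit t) →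
        IsClosed ({x} : Set X) ∧ cutIdeal ι x (tInit t) = maximalIdeal (X.presheaf.stalk x)) ∧
      (∀ w ∈ Subtype.val '' genericPoints ↥Z, ∃ z ∈ Z, w ⤳ z ∧ IsClosed ({z} : Set X) ∧
        ∃ (h : Fin (N + 1)) (hz : z ∈ chart ι h),
          IsRegularLocalRing (X.presheaf.stalk z ⧸ stalkIdeal (vanishingIdeal ⟨Z, hZ⟩) z) ∧
          ringKrullDim (X.presheaf.stalk z ⧸ stalkIdeal (vanishingIdeal ⟨Z, hZ⟩) z) = d ∧
          LinearIndependent k (fun a : Fin (d + 1) =>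
            jetMap ι hι h z hz (stalkIdeal (vanishingIdeal ⟨Z, hZ⟩) z) (t (Fin.castSucc a))) ∧
          z ∉ hyp ι (t 0)) ∧
      ((∀ x : X, IsIntegrallyClosed (X.presheaf.stalk x)) →
        ∀ x : X, IsClosed ({x} : Set X) → x ∈ cutSet ι (Fin.take d (Nat.le_add_right d 2) t) →
          IsRegularLocalRing (X.presheaf.stalk x ⧸ cutIdeal ι x (Fin.take d (Nat.le_add_right d 2) t)) ∧
          ringKrullDim (X.presheaf.stalk x ⧸ cutIdeal ι x (Fin.take d (Nat.le_add_right d 2) t)) ≤ 1) := by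
  classical
  -- instances
  haveI : IsLocallyNoetherian X := LocallyOfFiniteType.isLocallyNoetherian (X ↘ Spec (.of k))
  haveI : CompactSpace X := QuasiCompact.compactSpace_of_compactSpace (X ↘ Spec (.of k))
  haveI : IsNoetherian X := ⟨⟩
  -- the ideal of `Z` at a point, and dimensions
  let J : ∀ z : X, Ideal (X.presheaf.stalk z) := fun z => stalkIdeal (vanishingIdeal ⟨Z, hZ⟩) z
  have hZne : Z ≠ Set.univ := fun h => DeJong1996.NormalProjectivePair.genericPoint_notMem_support hD (by rw [hZD, h]; trivial)
  have hdimX := topologicalKrullDim_univ_lt (X := X) hdim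
  have hdimZ := topologicalKrullDim_Z_lt (X := X) hdim hZ hD hZD
  have hdimS := topologicalKrullDim_singSet_lt_succ (k := k) (X := X) hdim
  have hScl : IsClosed (singSet X) := isClosed_singSet (X ↘ Spec (.of k))
  -- the points `z_w`, one for each component of `Z`
  have hpts : ∀ w : ↥(genPts Z), ∃ z ∈ Z, (w : X) ⤳ z ∧ IsClosed ({z} : Set X) ∧
      IsRegularLocalRing (X.presheaf.stalk z ⧸ J z) := fun w =>
    exists_closed_regular_point_of_mem_genericPoints hZ (X ↘ Spec (.of k)) w.2
  choose zOf hzZ hwz hzc hreg using hpts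
  have hch : ∀ w : ↥(genPts Z), ∃ h : Fin (N + 1), zOf w ∈ chart ι h := fun w => exists_mem_chart ι (zOf w)
  choose hOf hzh using hch
  have hdimR : ∀ w : ↥(genPts Z), ringKrullDim (X.presheaf.stalk (zOf w) ⧸ J (zOf w)) = d := by
    intro w
    refine le_antisymm ?_ (le_ringKrullDim_quotient_stalkIdeal hZ (X ↘ Spec (.of k)) hD hZD hdim (hzZ w) (hzc w))
    obtain ⟨z', hz'⟩ : zOf w ∈ Set.range (vanishingIdeal ⟨Z, hZ⟩ : Scheme.IdealSheafData X).subschemeι := by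
      rw [range_subschemeι_vanishingIdeal]; exact hzZ w
    rw [← ringKrullDim_stalk_reduced_eq hZ z' hz']
    exact ringKrullDim_stalk_reduced_le hZ hdim hZne z'
  have hbij : ∀ w : ↥(genPts Z),
      Function.Bijective (algebraMap k (ResidueField (X.presheaf.stalk (zOf w)))) := fun w =>
    bijective_algebraMap_residueField_stalk ι hι (hzh w) (hzc w)
  letI : Fintype ↥(genPts Z) := (genPts_finite Z).fintype
  -- the generic conditions
  let P : ∀ j : ℕ, (Fin j → Fin (N + 1) → k) → (Fin (N + 1) → k) → Prop := fun j a b =>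
    (∀ w ∈ genPts (Set.univ ∩ cutSet ι a), w ∉ hyp ι b) ∧
    (∀ w ∈ genPts (Z ∩ cutSet ι a), w ∉ hyp ι b) ∧
    (∀ w ∈ genPts (singSet X ∩ cutSet ι a), w ∉ hyp ι b) ∧
    BertiniStep ι a b ∧
    (∀ w : ↥(genPts Z), zOf w ∉ hyp ι b) ∧
    (∀ w : ↥(genPts Z), j < d + 1 →
      jetMap ι hι (hOf w) (zOf w) (hzh w) (J (zOf w)) b ∉
        Submodule.span k (Set.range fun i => jetMap ι hι (hOf w) (zOf w) (hzh w) (J (zOf w)) (a i)))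
  have hP : ∀ j a, IsGeneric (P j a) := by
    intro j a
    refine (isGeneric_avoid_genPts ι _).and ((isGeneric_avoid_genPts ι _).and
      ((isGeneric_avoid_genPts ι _).and ((isGeneric_bertiniStep ι a).and
        ((IsGeneric.forall_fintype fun w => isGeneric_notMem_hyp ι (zOf w)).and
          (IsGeneric.forall_fintype fun w => ?_)))))
    by_cases hj : j < d + 1
    · haveI := hreg w
      exact (isGeneric_jetMap_notMem ι hι (hOf w) (zOf w) (hzh w) (J (zOf w)) (hzc w) _
        (span_jets_ne_top_of_lt (J (zOf w)) (hdimR w) (hbij w) hj _)).mono fun b hb _ => hb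
    · exact IsGeneric.of_forall fun b h => absurd h hj
  obtain ⟨t, ht⟩ := exists_seq_of_isGeneric P hP (d + 1 + 1)
  -- the consequences
  have hXd : ∀ (j : ℕ) (hj : j < d + 1 + 1), ∀ w ∈ genPts (cutOf ι Set.univ t j hj.le), w ∉ hyp ι (t ⟨j, hj⟩) :=
    fun j hj => (ht j hj).1
  have hZd : ∀ (j : ℕ) (hj : j < d + 1 + 1), ∀ w ∈ genPts (cutOf ι Z t j hj.le), w ∉ hyp ι (t ⟨j, hj⟩) :=
    fun j hj => (ht j hj).2.1
  have hSd : ∀ (j : ℕ) (hj : j < d + 1 + 1), ∀ w ∈ genPts (cutOf ι (singSet X) t j hj.le), w ∉ hyp ι (t ⟨j, hj⟩) :=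
    fun j hj => (ht j hj).2.2.1
  have hB : ∀ (j : ℕ) (hj : j < d + 1 + 1), BertiniStep ι (Fin.take j hj.le t) (t ⟨j, hj⟩) :=
    fun j hj => (ht j hj).2.2.2.1
  have hA : ∀ (j : ℕ) (hj : j < d + 1 + 1) (w : ↥(genPts Z)), zOf w ∉ hyp ι (t ⟨j, hj⟩) :=
    fun j hj => (ht j hj).2.2.2.2.1
  have hJt : ∀ (j : ℕ) (hj : j < d + 1 + 1) (w : ↥(genPts Z)), j < d + 1 →
      jetMap ι hι (hOf w) (zOf w) (hzh w) (J (zOf w)) (t ⟨j, hj⟩) ∉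
        Submodule.span k (Set.range fun i =>
          jetMap ι hι (hOf w) (zOf w) (hzh w) (J (zOf w)) (Fin.take j hj.le t i)) :=
    fun j hj => (ht j hj).2.2.2.2.2
  have htInit : tInit t = Fin.take (d + 1) (Nat.le_succ _) t := rfl
  -- (C1)
  have hC1 : NoCommonZero ι t := by
    rw [noCommonZero_iff_cutSet_eq_empty]
    have h := cutOf_eq_empty ι isClosed_univ t hXd (d + 1) hdimX le_rfl
    rwa [cutOf, Fin.take_eq_self, Set.univ_inter] at h
  -- (C2)
  have hC2 : ∀ z ∈ Z, z ∉ cutSet ι (tInit t) := by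
    intro z hz hzc
    have h := cutOf_eq_empty ι hZ t hZd d hdimZ (Nat.le_succ _)
    rw [cutOf] at h
    exact (Set.eq_empty_iff_forall_notMem.mp h) z ⟨hz, by rwa [← htInit]⟩
  -- the common zeros of `t₀, …, t_d`: closed points, off `Sing X`, zero-dimensional
  have hcut0 : topologicalKrullDim ↥(cutSet ι (tInit t)) < (1 : ℕ) := by
    have h := topologicalKrullDim_cutOf_lt ι isClosed_univ t hXd (d + 1) hdimX (d + 1) (Nat.le_succ _) (Nat.le_succ _)
    rw [cutOf, Set.univ_inter, ← htInit] at h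
    simpa using h
  have hC3 : ∀ x : X, x ∈ cutSet ι (tInit t) →
      IsClosed ({x} : Set X) ∧ cutIdeal ι x (tInit t) = maximalIdeal (X.presheaf.stalk x) := by
    intro x hx
    have hxc : IsClosed ({x} : Set X) :=
      isClosed_singleton_of_topologicalKrullDim_lt_one (isClosed_cutSet ι _) hcut0 hx
    have hxs : x ∉ singSet X := by
      intro hxs
      have h := cutOf_eq_empty ι hScl t hSd d hdimS (Nat.le_succ _)
      rw [cutOf] at h
      exact (Set.eq_empty_iff_forall_notMem.mp h) x ⟨hxs, by rwa [← htInit]⟩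
    refine ⟨hxc, ?_⟩
    have hregx := isRegularLocalRing_cut_of_steps ι t hB (d + 1) (Nat.le_succ _) x hxc (by rwa [← htInit]) hxs
    rw [htInit]
    exact cutIdeal_eq_maximalIdeal ι x _ hregx (by
      rw [← htInit]; exact (ENat.WithBot.lt_add_one_iff (m := 0)).mp (by simpa using hcut0))
  -- (C4)
  have hind : ∀ w : ↥(genPts Z), ∀ (j : ℕ) (hj : j ≤ d + 1), LinearIndependent k
      (fun i : Fin j => jetMap ι hι (hOf w) (zOf w) (hzh w) (J (zOf w))
        (Fin.take j (hj.trans (Nat.le_succ _)) t i)) := by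
    intro w j
    induction j with
    | zero => intro _; exact linearIndependent_empty_type
    | succ j ih =>
      intro hj
      have hj' : j < d + 1 := hj
      have hjn : j < d + 1 + 1 := hj'.trans (Nat.lt_succ_self _)
      have e : (fun i : Fin (j + 1) => jetMap ι hι (hOf w) (zOf w) (hzh w) (J (zOf w))
          (Fin.take (j + 1) (hj.trans (Nat.le_succ _)) t i)) =
          Fin.snoc (fun i : Fin j => jetMap ι hι (hOf w) (zOf w) (hzh w) (J (zOf w))
            (Fin.take j hjn.le t i)) (jetMap ι hι (hOf w) (zOf w) (hzh w) (J (zOf w)) (t ⟨j, hjn⟩)) := by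
        rw [Fin.take_succ_eq_snoc j hjn t]
        exact (Fin.comp_snoc (jetMap ι hι (hOf w) (zOf w) (hzh w) (J (zOf w))) _ _)
      rw [e, linearIndependent_finSnoc]
      exact ⟨ih hj'.le, hJt j hjn w hj'⟩
  have hC4 : ∀ w ∈ Subtype.val '' genericPoints ↥Z, ∃ z ∈ Z, w ⤳ z ∧ IsClosed ({z} : Set X) ∧
      ∃ (h : Fin (N + 1)) (hz : z ∈ chart ι h),
        IsRegularLocalRing (X.presheaf.stalk z ⧸ J z) ∧ ringKrullDim (X.presheaf.stalk z ⧸ J z) = d ∧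
        LinearIndependent k (fun a : Fin (d + 1) => jetMap ι hι h z hz (J z) (t (Fin.castSucc a))) ∧
        z ∉ hyp ι (t 0) := by
    intro w hw
    let w' : ↥(genPts Z) := ⟨w, hw⟩
    refine ⟨zOf w', hzZ w', hwz w', hzc w', hOf w', hzh w', hreg w', hdimR w', ?_, ?_⟩
    · exact hind w' (d + 1) le_rfl
    · exact hA 0 (Nat.zero_lt_succ _) w'
  -- (C5)
  have hC5 : (∀ x : X, IsIntegrallyClosed (X.presheaf.stalk x)) →
      ∀ x : X, IsClosed ({x} : Set X) → x ∈ cutSet ι (Fin.take d (Nat.le_add_right d 2) t) →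
        IsRegularLocalRing (X.presheaf.stalk x ⧸ cutIdeal ι x (Fin.take d (Nat.le_add_right d 2) t)) ∧
        ringKrullDim (X.presheaf.stalk x ⧸ cutIdeal ι x (Fin.take d (Nat.le_add_right d 2) t)) ≤ 1 := by
    intro hN x hxc hx
    -- `x ∉ Sing X`: `Sing X ∩ V(t₀,…,t_{d-1}) = ∅` as `dim Sing X < d`
    have hxs : x ∉ singSet X := by
      have hlt := topologicalKrullDim_singSet_lt (X ↘ Spec (.of k)) hN hdim hScl
      intro hxs
      cases d with
      | zero =>
        have h0 := eq_empty_of_topologicalKrullDim_lt_zero hScl (by simpa using hlt)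
        rw [h0] at hxs; exact hxs
      | succ d' =>
        have h := cutOf_eq_empty ι hScl t hSd d' hlt (by omega)
        rw [cutOf] at h
        exact (Set.eq_empty_iff_forall_notMem.mp h) x ⟨hxs, hx⟩
    refine ⟨isRegularLocalRing_cut_of_steps ι t hB d _ x hxc hx hxs, ?_⟩
    refine (ringKrullDim_quotient_cutIdeal_le ι x _).trans ?_
    have h := topologicalKrullDim_cutOf_lt ι isClosed_univ t hXd (d + 1) hdimX d (Nat.le_add_right d 2) (by omega)
    rw [cutOf, Set.univ_inter] at h
    have h' : topologicalKrullDim ↥(cutSet ι (Fin.take d (Nat.le_add_right d 2) t)) < ((1 + 1 : ℕ) : WithBot ℕ∞) := by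
      convert h using 2; omega
    exact ENat.WithBot.lt_add_one_iff.mp h'
  exact ⟨t, hC1, hC2, hC3, hC4, hC5⟩

end LinSec

end Literature.AlgebraicGeometry.Resolution

end
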